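import Summits.Ventures.Crystal3D.Theorems.StickyWulffConstantNoReconstructionGainCellFluxGlue
import Summits.Ventures.Crystal3D.Theorems.StickyWulffConstantNoReconstructionGainBlanketGlue
import HarnessLib

/-!
# The CellFlux chain in one statement: pool local lemma ⇒ blanket bound ⇒ `NoReconstructionGain` at `±e₃`

HONEST FRAMING. Part of the venture `Summits/Ventures/Crystal3D` (cell `crystal3d-full`), helper
`--supports` the crux `NoReconstructionGain` (stmt-Ventures-19144, route
`route-Ventures-StickyWulffConstant`).  Bookkeeping only: composes the landed glue
(`shadowCovering`, `blanketOfPoolFlux` in `…CellFluxGlue`; `blanket_noReconstructionGain_e3/_neg_e3`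
in `…BlanketGlue`) into the conditional statements the planner's architecture γ aims at:

* `noReconstructionGainAt_e3_of_blanketBound` / `…_neg_e3_…` — cf-p1's `BlanketToNRGAt3 / AtNeg3`
  with the LANDED definition `CellFlux.BlanketBound` as hypothesis;
* `noReconstructionGainAt_e3_of_poolFluxBound` — for any `a ≥ 1/√3`, `a, κ > 0`:
  `PoolFluxBound a κ → NoReconstructionGain at e₃` (`R = 1`, `C = 4π`), and the same at `−e₃`.

WHAT THIS IS NOT: a proof of `PoolFluxBound fluxRadius 1` (censused, unproved) or of the blanket
bound; other normals; rung F-C1 not moved.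
-/

noncomputable section

namespace Summit.Ventures.Crystal3D.Theorems

open Summit.Ventures.Crystal3D Finset MeasureTheory
open Summit.Ventures.Crystal3D.Cruxes.NoReconstructionGain.CellFlux
open Literature.MathematicalPhysics.StatisticalMechanics (fccStacking)
open scoped InnerProductSpace

/-- `BlanketBound` (the landed definition) ⇒ `NoReconstructionGain` at `e₃` (`R = 1`, `C = 4π`). -/
theorem noReconstructionGainAt_e3_of_blanketBound (h : BlanketBound) :
    ∃ R C : ℝ, 0 < R ∧ ∀ ρ : ℝ, R ≤ ρ →
      ∀ (N : ℕ) (x : Fin N → EuclideanSpace ℝ (Fin 3)), IsUnitPacking x →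
        (∀ p ∈ fccStacking 1 (Real.sqrt (2 / 3)),
            -(2 * R) ≤ ⟪p, EuclideanSpace.single (2 : Fin 3) (1 : ℝ)⟫_ℝ →
            ⟪p, EuclideanSpace.single (2 : Fin 3) (1 : ℝ)⟫_ℝ ≤ -R →
            ‖p‖ ^ 2 - ⟪p, EuclideanSpace.single (2 : Fin 3) (1 : ℝ)⟫_ℝ ^ 2 ≤ ρ ^ 2 → ∃ i, x i = p) →
          2 * (Real.sqrt 2 / 4 *
                ∑ᶠ w ∈ {w ∈ fccStacking 1 (Real.sqrt (2 / 3)) | ‖w‖ = 1},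
                  |⟪w, EuclideanSpace.single (2 : Fin 3) (1 : ℝ)⟫_ℝ|) *
              Real.pi * ρ ^ 2 - C * ρ ≤ 6 * (N : ℝ) - (numContacts x : ℝ) :=
  blanket_noReconstructionGain_e3 h

/-- `BlanketBound` (the landed definition) ⇒ `NoReconstructionGain` at `−e₃`. -/
theorem noReconstructionGainAt_neg_e3_of_blanketBound (h : BlanketBound) :
    ∃ R C : ℝ, 0 < R ∧ ∀ ρ : ℝ, R ≤ ρ →
      ∀ (N : ℕ) (x : Fin N → EuclideanSpace ℝ (Fin 3)), IsUnitPacking x →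
        (∀ p ∈ fccStacking 1 (Real.sqrt (2 / 3)),
            -(2 * R) ≤ ⟪p, -EuclideanSpace.single (2 : Fin 3) (1 : ℝ)⟫_ℝ →
            ⟪p, -EuclideanSpace.single (2 : Fin 3) (1 : ℝ)⟫_ℝ ≤ -R →
            ‖p‖ ^ 2 - ⟪p, -EuclideanSpace.single (2 : Fin 3) (1 : ℝ)⟫_ℝ ^ 2 ≤ ρ ^ 2 → ∃ i, x i = p) →
          2 * (Real.sqrt 2 / 4 *
                ∑ᶠ w ∈ {w ∈ fccStacking 1 (Real.sqrt (2 / 3)) | ‖w‖ = 1},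
                  |⟪w, -EuclideanSpace.single (2 : Fin 3) (1 : ℝ)⟫_ℝ|) *
              Real.pi * ρ ^ 2 - C * ρ ≤ 6 * (N : ℝ) - (numContacts x : ℝ) :=
  blanket_noReconstructionGain_neg_e3 h

/-- **The CellFlux chain.**  For semi-axes `a ≥ 1/√3`, `a, κ > 0`: the POOL local lemma
`PoolFluxBound a κ` implies `NoReconstructionGain` at `e₃` (via `shadowCovering`,
`blanketOfPoolFlux`, `blanket_noReconstructionGain_e3`). -/
theorem noReconstructionGainAt_e3_of_poolFluxBound (a κ : ℝ) (hr : blanketRadius ≤ a) (ha : 0 < a)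
    (hκ : 0 < κ) (hpool : PoolFluxBound a κ) :
    ∃ R C : ℝ, 0 < R ∧ ∀ ρ : ℝ, R ≤ ρ →
      ∀ (N : ℕ) (x : Fin N → EuclideanSpace ℝ (Fin 3)), IsUnitPacking x →
        (∀ p ∈ fccStacking 1 (Real.sqrt (2 / 3)),
            -(2 * R) ≤ ⟪p, EuclideanSpace.single (2 : Fin 3) (1 : ℝ)⟫_ℝ →
            ⟪p, EuclideanSpace.single (2 : Fin 3) (1 : ℝ)⟫_ℝ ≤ -R →
            ‖p‖ ^ 2 - ⟪p, EuclideanSpace.single (2 : Fin 3) (1 : ℝ)⟫_ℝ ^ 2 ≤ ρ ^ 2 → ∃ i, x i = p) →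
          2 * (Real.sqrt 2 / 4 *
                ∑ᶠ w ∈ {w ∈ fccStacking 1 (Real.sqrt (2 / 3)) | ‖w‖ = 1},
                  |⟪w, EuclideanSpace.single (2 : Fin 3) (1 : ℝ)⟫_ℝ|) *
              Real.pi * ρ ^ 2 - C * ρ ≤ 6 * (N : ℝ) - (numContacts x : ℝ) :=
  noReconstructionGainAt_e3_of_blanketBound
    (blanketOfPoolFlux a κ hr (shadowCovering a κ ha hκ)
      (fun N x hx ν hν i hi => by
        -- the `d = 0` instance (formally a hypothesis of the target) follows from the pool bound:
        -- an isolated ball has an empty neighbour sum, so its positive excess is `≤ 0`.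
        have h := hpool N x hx ν hν i
        have h0 : contactNeighbors x i = ∅ := by
          have : (contactNeighbors x i).card = 0 := hi
          exact card_eq_zero.1 this
        rw [h0, sum_empty] at h
        have h' := le_trans (le_max_left _ _) h
        unfold excess at h'
        rw [hi] at h'
        push_cast at h' ⊢
        linarith)
      hpool)

/-- The same at `−e₃`. -/
theorem noReconstructionGainAt_neg_e3_of_poolFluxBound (a κ : ℝ) (hr : blanketRadius ≤ a) (ha : 0 < a)
    (hκ : 0 < κ) (hpool : PoolFluxBound a κ) :
    ∃ R C : ℝ, 0 < R ∧ ∀ ρ : ℝ, R ≤ ρ →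
      ∀ (N : ℕ) (x : Fin N → EuclideanSpace ℝ (Fin 3)), IsUnitPacking x →
        (∀ p ∈ fccStacking 1 (Real.sqrt (2 / 3)),
            -(2 * R) ≤ ⟪p, -EuclideanSpace.single (2 : Fin 3) (1 : ℝ)⟫_ℝ →
            ⟪p, -EuclideanSpace.single (2 : Fin 3) (1 : ℝ)⟫_ℝ ≤ -R →
            ‖p‖ ^ 2 - ⟪p, -EuclideanSpace.single (2 : Fin 3) (1 : ℝ)⟫_ℝ ^ 2 ≤ ρ ^ 2 → ∃ i, x i = p) →
          2 * (Real.sqrt 2 / 4 *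
                ∑ᶠ w ∈ {w ∈ fccStacking 1 (Real.sqrt (2 / 3)) | ‖w‖ = 1},
                  |⟪w, -EuclideanSpace.single (2 : Fin 3) (1 : ℝ)⟫_ℝ|) *
              Real.pi * ρ ^ 2 - C * ρ ≤ 6 * (N : ℝ) - (numContacts x : ℝ) :=
  noReconstructionGainAt_neg_e3_of_blanketBound
    (blanketOfPoolFlux a κ hr (shadowCovering a κ ha hκ)
      (fun N x hx ν hν i hi => by
        have h := hpool N x hx ν hν i
        have h0 : contactNeighbors x i = ∅ := by
          have : (contactNeighbors x i).card = 0 := hi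
          exact card_eq_zero.1 this
        rw [h0, sum_empty] at h
        have h' := le_trans (le_max_left _ _) h
        unfold excess at h'
        rw [hi] at h'
        push_cast at h' ⊢
        linarith)
      hpool)

/-- The STAR handshake: summing the star inequalities gives `Σᵢ eᵢ ≤ λ · Σ_{deg = 0} eᵢ`. -/
theorem sum_excess_le_of_star {a κ lam : ℝ} {N : ℕ} (x : Fin N → EuclideanSpace ℝ (Fin 3))
    (ν : EuclideanSpace ℝ (Fin 3))
    (hstar : ∀ i, (1 - lam) * excess ν a κ x i +
      lam * ∑ j ∈ contactNeighbors x i, excess ν a κ x j / (coordination x j : ℝ) ≤ 0) :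
    ∑ i, excess ν a κ x i ≤
      lam * ∑ i, (if coordination x i = 0 then excess ν a κ x i else 0) := by
  classical
  set e := fun i => excess ν a κ x i with he
  have hswap : ∑ i, ∑ j ∈ contactNeighbors x i, e j / (coordination x j : ℝ) =
      ∑ j, (coordination x j : ℝ) * (e j / (coordination x j : ℝ)) := by
    rw [sum_comm' (t' := univ) (s' := fun j => contactNeighbors x j)]
    · refine sum_congr rfl fun j _ => ?_
      rw [sum_const, nsmul_eq_mul]; rfl
    · intro i j
      simp only [mem_univ, true_and, and_true]
      exact mem_contactNeighbors_comm x
  have hshare : ∀ j, (coordination x j : ℝ) * (e j / (coordination x j : ℝ)) =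
      e j - (if coordination x j = 0 then e j else 0) := by
    intro j
    by_cases h0 : coordination x j = 0
    · rw [if_pos h0, h0]; simp
    · rw [if_neg h0, mul_div_cancel₀ _ (by exact_mod_cast h0 : (coordination x j : ℝ) ≠ 0)]; ring
  have hsum : ∑ i, ((1 - lam) * e i + lam * ∑ j ∈ contactNeighbors x i, e j / (coordination x j : ℝ)) ≤ 0 :=
    sum_nonpos fun i _ => hstar i
  rw [sum_add_distrib, ← mul_sum, ← mul_sum, hswap, sum_congr rfl fun j _ => hshare j,
    sum_sub_distrib] at hsum
  have : ∑ i, excess ν a κ x i = ∑ i, e i := rfl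
  rw [this]
  linarith

/-- **`BlanketOfStarFlux a κ λ`** (glue; cf-p1 g15, registered by name): the covering lemma, the
`d = 0` instance and the STAR local lemma give the blanket bound. -/
theorem blanketOfStarFlux : ∀ a κ lam : ℝ,
    Summit.Ventures.Crystal3D.Cruxes.NoReconstructionGain.CellFlux.BlanketOfStarFlux a κ lam := by
  intro a κ lam hr h0 _ hSC hLF0 hStar N x hx ν hν
  have h1 := shadowArea_mono ν hν blanketRadius_nonneg hr x
  have h2 := hSC N x ν hν
  have h3 := sum_excess_le_of_star x ν (hStar N x hx ν hν)
  have hiso : ∑ i, (if coordination x i = 0 then excess ν a κ x i else 0) ≤ 0 := by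
    refine sum_nonpos fun i _ => ?_
    split_ifs with hi
    · have := hLF0 N x hx ν hν i hi
      unfold excess; rw [hi]; push_cast at this ⊢; linarith
    · exact le_rfl
  have h3' : ∑ i, excess ν a κ x i ≤ 0 := h3.trans (mul_nonpos_of_nonneg_of_nonpos h0 hiso)
  have h4 : ∑ i, excess ν a κ x i =
      2 * Real.sqrt 3 * ∑ i, cellFlux ν a κ x i - (12 * (N : ℝ) - 2 * (numContacts x : ℝ)) := by
    unfold excess
    rw [sum_sub_distrib, ← mul_sum, sum_sub_distrib, sum_const, card_univ, Fintype.card_fin,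
      nsmul_eq_mul]
    have h5 : ∑ i, (coordination x i : ℝ) = 2 * (numContacts x : ℝ) := by
      exact_mod_cast sum_coordination_eq x
    rw [h5]; ring
  have h3pos : 0 ≤ Real.sqrt 3 := Real.sqrt_nonneg 3
  nlinarith [h1, h2, h3', h4, mul_le_mul_of_nonneg_left h1 h3pos, mul_le_mul_of_nonneg_left h2 h3pos]

end Summit.Ventures.Crystal3D.Theorems
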